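import Mathlib
import Summits.KontsevichZagierPeriods.KontsevichZagierPeriods.Theorems.SoloInformedChord
import Summits.KontsevichZagierPeriods.KontsevichZagierPeriods.Theorems.SoloInformedCoonsBox
import Literature.AlgebraicTopology.Homotopy.CollaredDeformationRetract
import HarnessLib

/-!
# SoloInformed — the Stokes grid of a homotopy, I: setting, scales, grid points and vertices

File I4d of the (HT) step (`SoloInformedNashHT`) of the solo-informed programme.

* `SoloInformedHTSetting Z`: the data of (HT) after unpacking the homotopy — Nash maps `a, b, d`
  with `a 1 = b 0` and a continuous `G : I × I → Z(ℂ)` with `G(0, ·) = a · b` (concatenation),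
  `G(1, ·) = d`, and constant bottom and top rows.
* `SoloInformedHTScale S`: the scales of the grid — a coarse radius `ρ` (cells lie in cores of
  charts), a fine radius `δ ≤ ρ` (chords lie in cores of charts of core diameter `< ρ/4`), a
  modulus of uniform continuity `η` of `G` for `δ/4`, and mesh sizes `N`, `M₀ + M₀` finer than `η`.
* grid parameter points `upt i j`, grid points `gpt i j = G (upt i j)`, and the **vertices**
  `vert i j`: the grid point itself on the boundary of the parameter square, and a `δ/4`-close
  point of `Z(ℚ̄)` (density, Huber–Wüstholz §3.3.1) in the interior; their algebraicity, and their
  membership in the cores of the edge charts.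

References: Huber–Wüstholz, *Transcendence and linear relations of 1-periods* (2022), §3.3.1,
§7.2; Munkres, *Topology*, Lemma 27.5.
-/

noncomputable section

open scoped Topology unitInterval
open Set Metric
open Literature.NumberTheory.Transcendental Literature.NumberTheory.Transcendental.KZ
open Literature.NumberTheory.Transcendental.CurvePeriods
open Literature.ModelTheory.ExponentialFields
open Literature.AlgebraicTopology.Homotopy (clampI clampI_zero clampI_one coe_clampI_of_mem)

namespace Summit.KontsevichZagierPeriods.KontsevichZagierPeriods.Theorems

variable {Z : CurveData}

/-! ## 1. Projection to the unit interval

We use the clamp `clampI : ℝ → I` of `Literature.AlgebraicTopology.Homotopy`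
(`Set.projIcc 0 1`), with `clampI_zero`, `clampI_one`, `coe_clampI_of_mem`. -/

/-- The clamp into `[0, 1]` is `1`-Lipschitz. -/
theorem soloInformed_dist_clampI_le (x y : ℝ) :
    dist (clampI x) (clampI y) ≤ |x - y| := by
  rw [Subtype.dist_eq, Real.dist_eq]
  exact Set.abs_projIcc_sub_projIcc (h := zero_le_one)

/-! ## 2. The setting -/

/-- **The data of (HT) after unpacking the homotopy.** -/
structure SoloInformedHTSetting (Z : CurveData) where
  /-- the first path -/
  a : ℝ → Fin Z.n → ℂ
  /-- the second path -/
  b : ℝ → Fin Z.n → ℂ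
  /-- the path homotopic to the concatenation -/
  d : ℝ → Fin Z.n → ℂ
  ha : SoloInformedIsNashPath a
  hb : SoloInformedIsNashPath b
  hd : SoloInformedIsNashPath d
  hab : a 1 = b 0
  /-- the homotopy from `a · b` to `d` -/
  G : I × I → Fin Z.n → ℂ
  hG : Continuous G
  G_mem : ∀ u, G u ∈ Z.points
  G_left : ∀ t : I, G (0, t) = if (t : ℝ) ≤ 1 / 2 then a (2 * t) else b (2 * t - 1)
  G_right : ∀ t : I, G (1, t) = d t
  G_bot : ∀ s : I, G (s, 0) = G (0, 0)
  G_top : ∀ s : I, G (s, 1) = G (0, 1)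

namespace SoloInformedHTSetting

variable (S : SoloInformedHTSetting Z)

/-- The concatenation `a · b` as a function on `ℝ`. -/
def cat (t : ℝ) : Fin Z.n → ℂ := if t ≤ 1 / 2 then S.a (2 * t) else S.b (2 * t - 1)

/-- The left side of the homotopy is the concatenation `a · b`. -/
theorem G_zero_left (t : I) : S.G (0, t) = S.cat t := S.G_left t

/-- On `[0, 1/2]` the concatenation runs through `a` at double speed. -/
theorem cat_of_le {t : ℝ} (ht : t ≤ 1 / 2) : S.cat t = S.a (2 * t) := if_pos ht

/-- On `[1/2, 1]` the concatenation runs through `b` at double speed. -/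
theorem cat_of_ge {t : ℝ} (ht : 1 / 2 ≤ t) : S.cat t = S.b (2 * t - 1) := by
  rcases ht.eq_or_lt with h | h
  · rw [← h, S.cat_of_le le_rfl]
    norm_num
    exact S.hab
  · exact if_neg (not_le.2 h)

/-- `a · b` takes algebraic values at rational times. -/
theorem cat_alg {q : ℚ} (hq : (q : ℝ) ∈ Icc (0 : ℝ) 1) (k : Fin Z.n) :
    IsAlgebraic ℚ (S.cat q k) := by
  by_cases h : (q : ℝ) ≤ 1 / 2
  · rw [S.cat_of_le h, show (2 : ℝ) * q = ((2 * q : ℚ) : ℝ) by push_cast; ring]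
    exact S.ha.isAlgebraic_apply_rat ⟨by push_cast; linarith [hq.1], by push_cast; linarith⟩ k
  · rw [S.cat_of_ge (not_le.1 h).le,
      show (2 : ℝ) * q - 1 = ((2 * q - 1 : ℚ) : ℝ) by push_cast; ring]
    exact S.hb.isAlgebraic_apply_rat
      ⟨by push_cast; linarith [(not_le.1 h).le], by push_cast; linarith [hq.2]⟩ k

/-- Points of the left side at rational heights are algebraic (Nash paths at rational times). -/
theorem G_alg_left {q : ℚ} (hq : (q : ℝ) ∈ Icc (0 : ℝ) 1) (k : Fin Z.n) :
    IsAlgebraic ℚ (S.G (0, clampI q) k) := by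
  rw [S.G_zero_left, coe_clampI_of_mem hq]
  exact S.cat_alg hq k

/-- Points of the right side at rational heights are algebraic. -/
theorem G_alg_right {q : ℚ} (hq : (q : ℝ) ∈ Icc (0 : ℝ) 1) (k : Fin Z.n) :
    IsAlgebraic ℚ (S.G (1, clampI q) k) := by
  rw [S.G_right, coe_clampI_of_mem hq]
  exact S.hd.isAlgebraic_apply_rat hq k

/-- The bottom row is the algebraic point `a 0`. -/
theorem G_alg_bot (s : I) (k : Fin Z.n) : IsAlgebraic ℚ (S.G (s, 0) k) := by
  rw [S.G_bot]
  have h := S.G_alg_left (q := 0) (by simp) k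
  simpa [clampI_zero] using h

/-- The top row is the algebraic point `b 1`. -/
theorem G_alg_top (s : I) (k : Fin Z.n) : IsAlgebraic ℚ (S.G (s, 1) k) := by
  rw [S.G_top]
  have h := S.G_alg_left (q := 1) (by simp) k
  simpa [clampI_one] using h

end SoloInformedHTSetting

/-! ## 3. Scales -/

/-- **The scales of the Stokes grid** of a setting `S`. -/
structure SoloInformedHTScale (S : SoloInformedHTSetting Z) where
  /-- coarse radius -/
  ρ : ℝ
  /-- fine radius -/
  δ : ℝ
  /-- modulus of uniform continuity of `G` for `δ / 4` -/
  η : ℝ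
  /-- number of columns -/
  N : ℕ
  /-- half the number of rows -/
  M₀ : ℕ
  ρ_pos : 0 < ρ
  δ_pos : 0 < δ
  δ_le : δ ≤ ρ
  N_pos : 0 < N
  M₀_pos : 0 < M₀
  coarse : ∀ k ∈ range S.G, ∃ c : SoloInformedChart Z, ball k ρ ∩ Z.points ⊆ soloInformedCore c
  fine : ∀ k ∈ range S.G, ∃ c : SoloInformedChart Z,
    ball k δ ∩ Z.points ⊆ soloInformedCore c ∧ soloInformedCore c ⊆ ball k (ρ / 4)
  unif : ∀ u u' : I × I, dist u u' < η → dist (S.G u) (S.G u') < δ / 4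
  N_mesh : 1 / (N : ℝ) < η
  M_mesh : 1 / ((M₀ : ℝ) + M₀) < η

namespace SoloInformedHTScale

variable {S : SoloInformedHTSetting Z} (P : SoloInformedHTScale S)

/-- number of rows -/
abbrev M : ℕ := P.M₀ + P.M₀

/-- The number of rows is `M = M₀ + M₀`, and it is positive. -/
theorem M_spec : P.M = P.M₀ + P.M₀ ∧ 0 < P.M := ⟨rfl, Nat.add_pos_left P.M₀_pos _⟩

/-- `M = M₀ + M₀` as real numbers. -/
theorem cast_M : (P.M : ℝ) = P.M₀ + P.M₀ := by simp [M]

/-- The vertical mesh `1 / M` is below the uniform-continuity modulus `η`. -/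
theorem M_mesh' : 1 / (P.M : ℝ) < P.η := by rw [P.cast_M]; exact P.M_mesh

/-- `j / M ∈ [0, 1]` for `j ≤ M`. -/
theorem div_M_mem {j : ℕ} (hj : j ≤ P.M) : (j : ℝ) / P.M ∈ Icc (0 : ℝ) 1 :=
  ⟨by positivity, (div_le_one (by exact_mod_cast P.M_spec.2)).2 (by exact_mod_cast hj)⟩

/-! ## 4. Grid points -/

/-- grid parameter point `(i/N, j/M)` (projected to `I × I`) -/
def upt (i j : ℕ) : I × I := (clampI ((i : ℝ) / P.N), clampI ((j : ℝ) / P.M))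

/-- grid point `G(i/N, j/M)` -/
def gpt (i j : ℕ) : Fin Z.n → ℂ := S.G (P.upt i j)

/-- Grid points are curve points. -/
theorem gpt_mem (i j : ℕ) : P.gpt i j ∈ Z.points := S.G_mem _

/-- Grid points lie in the image of the homotopy. -/
theorem gpt_mem_range (i j : ℕ) : P.gpt i j ∈ range S.G := mem_range_self _

/-- The height of the parameter point `(i, j)` is `j / M`. -/
theorem upt_snd {i j : ℕ} (hj : j ≤ P.M) : ((P.upt i j).2 : ℝ) = j / P.M :=
  coe_clampI_of_mem (P.div_M_mem hj)

/-- Column `0` of parameter points has first coordinate `0`. -/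
theorem upt_fst_zero (j : ℕ) : (P.upt 0 j).1 = 0 := by
  simp only [upt, Nat.cast_zero, zero_div, clampI_zero]

/-- Column `N` of parameter points has first coordinate `1`. -/
theorem upt_fst_N (j : ℕ) : (P.upt P.N j).1 = 1 := by
  have h : (P.N : ℝ) / P.N = 1 := div_self (by exact_mod_cast P.N_pos.ne')
  simp only [upt, h, clampI_one]

/-- Row `0` of parameter points has height `0`. -/
theorem upt_snd_zero (i : ℕ) : (P.upt i 0).2 = 0 := by
  simp only [upt, Nat.cast_zero, zero_div, clampI_zero]

/-- Row `M` of parameter points has height `1`. -/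
theorem upt_snd_M (i : ℕ) : (P.upt i P.M).2 = 1 := by
  have h : (P.M : ℝ) / P.M = 1 := div_self (by exact_mod_cast P.M_spec.2.ne')
  simp only [upt, h, clampI_one]

/-- Row `0` of grid points is the constant `G (0, 0) = a 0`. -/
theorem gpt_row_zero (i : ℕ) : P.gpt i 0 = S.G (0, 0) := by
  rw [gpt, show P.upt i 0 = ((P.upt i 0).1, 0) from Prod.ext rfl (P.upt_snd_zero i), S.G_bot]

/-- Row `M` of grid points is the constant `G (0, 1) = b 1`. -/
theorem gpt_row_M (i : ℕ) : P.gpt i P.M = S.G (0, 1) := by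
  rw [gpt, show P.upt i P.M = ((P.upt i P.M).1, 1) from Prod.ext rfl (P.upt_snd_M i), S.G_top]

/-- Column `0` of grid points lies on the left side of the homotopy. -/
theorem gpt_col_zero (j : ℕ) : P.gpt 0 j = S.G (0, clampI ((j : ℝ) / P.M)) := by
  rw [gpt, show P.upt 0 j = (0, (P.upt 0 j).2) from Prod.ext (P.upt_fst_zero j) rfl]
  rfl

/-- Column `N` of grid points lies on the right side of the homotopy. -/
theorem gpt_col_N (j : ℕ) : P.gpt P.N j = S.G (1, clampI ((j : ℝ) / P.M)) := by
  rw [gpt, show P.upt P.N j = (1, (P.upt P.N j).2) from Prod.ext (P.upt_fst_N j) rfl]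
  rfl

/-- Column `0` of grid points consists of the points `(a · b) (j / M)`. -/
theorem gpt_col_zero_eq_cat {j : ℕ} (hj : j ≤ P.M) : P.gpt 0 j = S.cat ((j : ℝ) / P.M) := by
  rw [P.gpt_col_zero, S.G_zero_left, coe_clampI_of_mem (P.div_M_mem hj)]

/-- Column `N` of grid points consists of the points `d (j / M)`. -/
theorem gpt_col_N_eq {j : ℕ} (hj : j ≤ P.M) : P.gpt P.N j = S.d ((j : ℝ) / P.M) := by
  rw [P.gpt_col_N, S.G_right, coe_clampI_of_mem (P.div_M_mem hj)]

/-! ### Distances between neighbouring grid points -/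

/-- Points of the same column at parameter distance `≤ 1/M` are `δ/4`-close. -/
theorem dist_G_snd_lt (s : I) {t t' : ℝ} (h : |t - t'| ≤ 1 / (P.M : ℝ)) :
    dist (S.G (s, clampI t)) (S.G (s, clampI t')) < P.δ / 4 := by
  apply P.unif
  rw [Prod.dist_eq, dist_self, max_eq_right dist_nonneg]
  calc dist (clampI t) (clampI t') ≤ |t - t'| := soloInformed_dist_clampI_le t t'
    _ ≤ 1 / (P.M : ℝ) := h
    _ < P.η := P.M_mesh'

/-- Points of the same row at parameter distance `≤ 1/N` are `δ/4`-close. -/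
theorem dist_G_fst_lt (t : I) {s s' : ℝ} (h : |s - s'| ≤ 1 / (P.N : ℝ)) :
    dist (S.G (clampI s, t)) (S.G (clampI s', t)) < P.δ / 4 := by
  apply P.unif
  rw [Prod.dist_eq, dist_self, max_eq_left dist_nonneg]
  calc dist (clampI s) (clampI s') ≤ |s - s'| := soloInformed_dist_clampI_le s s'
    _ ≤ 1 / (P.N : ℝ) := h
    _ < P.η := P.N_mesh

/-- Horizontally adjacent grid points are `δ / 4`-close (mesh below `η`). -/
theorem dist_gpt_succ_fst (i j : ℕ) : dist (P.gpt (i + 1) j) (P.gpt i j) < P.δ / 4 := by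
  refine P.dist_G_fst_lt _ (le_of_eq ?_)
  have hN : (0 : ℝ) < P.N := by exact_mod_cast P.N_pos
  rw [show ((i + 1 : ℕ) : ℝ) / P.N - (i : ℝ) / P.N = 1 / P.N by push_cast; ring]
  exact abs_of_pos (by positivity)

/-- Vertically adjacent grid points are `δ / 4`-close (mesh below `η`). -/
theorem dist_gpt_succ_snd (i j : ℕ) : dist (P.gpt i (j + 1)) (P.gpt i j) < P.δ / 4 := by
  refine P.dist_G_snd_lt _ (le_of_eq ?_)
  have hM : (0 : ℝ) < P.M := by exact_mod_cast P.M_spec.2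
  rw [show ((j + 1 : ℕ) : ℝ) / P.M - (j : ℝ) / P.M = 1 / P.M by push_cast; ring]
  exact abs_of_pos (by positivity)

/-! ## 5. Vertices -/

open Classical in
/-- **Vertices**: the grid point on the boundary of the parameter square, a `δ/4`-close point of
`Z(ℚ̄)` in the interior (if there is one — there always is, by density). -/
def vert (i j : ℕ) : Fin Z.n → ℂ :=
  if i = 0 ∨ i = P.N ∨ j = 0 ∨ j = P.M then P.gpt i j
  else if h : ∃ z, z ∈ ball (P.gpt i j) (P.δ / 4) ∧ z ∈ Z.points ∧ ∀ k, IsAlgebraic ℚ (z k)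
    then h.choose else P.gpt i j

/-- Boundary vertices are the grid points themselves (no adjustment). -/
theorem vert_of_bdry {i j : ℕ} (h : i = 0 ∨ i = P.N ∨ j = 0 ∨ j = P.M) :
    P.vert i j = P.gpt i j := by
  rw [vert, if_pos h]

/-- Every vertex is a curve point `δ / 4`-close to its grid point. -/
theorem vert_spec (i j : ℕ) :
    P.vert i j ∈ ball (P.gpt i j) (P.δ / 4) ∧ P.vert i j ∈ Z.points := by
  rw [vert]
  split_ifs with h h'
  · exact ⟨mem_ball_self (by linarith [P.δ_pos]), P.gpt_mem i j⟩
  · exact ⟨h'.choose_spec.1, h'.choose_spec.2.1⟩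
  · exact ⟨mem_ball_self (by linarith [P.δ_pos]), P.gpt_mem i j⟩

/-- Every vertex is `δ / 4`-close to its grid point. -/
theorem dist_vert_gpt (i j : ℕ) : dist (P.vert i j) (P.gpt i j) < P.δ / 4 :=
  mem_ball.1 (P.vert_spec i j).1

/-- Vertices are curve points. -/
theorem vert_mem (i j : ℕ) : P.vert i j ∈ Z.points := (P.vert_spec i j).2

/-- Boundary grid points have algebraic coordinates. -/
theorem gpt_alg_bdry {i j : ℕ} (hi : i ≤ P.N) (hj : j ≤ P.M)
    (h : i = 0 ∨ i = P.N ∨ j = 0 ∨ j = P.M) (k : Fin Z.n) : IsAlgebraic ℚ (P.gpt i j k) := by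
  rcases h with rfl | rfl | rfl | rfl
  · have e : (((j : ℚ) / P.M : ℚ) : ℝ) = (j : ℝ) / P.M := by push_cast; rfl
    have h := S.cat_alg (q := (j : ℚ) / P.M) (by rw [e]; exact P.div_M_mem hj) k
    rw [e] at h
    rwa [P.gpt_col_zero_eq_cat hj]
  · rw [P.gpt_col_N_eq hj]
    exact S.hd.isAlgebraic_apply_div P.M_spec.2 hj k
  · rw [P.gpt_row_zero]
    exact S.G_alg_bot 0 k
  · rw [P.gpt_row_M]
    exact S.G_alg_top 0 k

/-- **Vertices have algebraic coordinates.** -/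
theorem vert_alg (hZ : Z.IsSmoothAffineCurve) {i j : ℕ} (hi : i ≤ P.N) (hj : j ≤ P.M)
    (k : Fin Z.n) : IsAlgebraic ℚ (P.vert i j k) := by
  rw [vert]
  split_ifs with h h'
  · exact P.gpt_alg_bdry hi hj h k
  · exact h'.choose_spec.2.2 k
  · exact absurd (hZ.exists_algebraicPoint_mem (P.gpt_mem i j) isOpen_ball
      (mem_ball_self (by linarith [P.δ_pos]))) h'

/-! ## 6. Cell charts and edge charts -/

/-- the chart of cell `(i, j)` (coarse radius at `gpt i j`) -/
def cellChart (i j : ℕ) : SoloInformedChart Z :=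
  (P.coarse (P.gpt i j) (P.gpt_mem_range i j)).choose

/-- Curve points within `ρ` of the grid point `(i, j)` lie in the core of the cell chart. -/
theorem mem_core_cell {i j : ℕ} {z : Fin Z.n → ℂ} (hz : z ∈ Z.points)
    (hd : dist z (P.gpt i j) < P.ρ) : z ∈ soloInformedCore (P.cellChart i j) :=
  (P.coarse (P.gpt i j) (P.gpt_mem_range i j)).choose_spec ⟨mem_ball.2 hd, hz⟩

/-- the chart of the edges issuing from vertex `(i, j)` (fine radius at `gpt i j`) -/
def edgeChart (i j : ℕ) : SoloInformedChart Z :=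
  (P.fine (P.gpt i j) (P.gpt_mem_range i j)).choose

/-- Curve points within `δ` of the grid point `(i, j)` lie in the core of the edge chart. -/
theorem mem_core_edge {i j : ℕ} {z : Fin Z.n → ℂ} (hz : z ∈ Z.points)
    (hd : dist z (P.gpt i j) < P.δ) : z ∈ soloInformedCore (P.edgeChart i j) :=
  (P.fine (P.gpt i j) (P.gpt_mem_range i j)).choose_spec.1 ⟨mem_ball.2 hd, hz⟩

/-- The core of the edge chart of `(i, j)` lies within `ρ / 4` of the grid point. -/
theorem dist_lt_of_mem_core_edge {i j : ℕ} {z : Fin Z.n → ℂ}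
    (hz : z ∈ soloInformedCore (P.edgeChart i j)) : dist z (P.gpt i j) < P.ρ / 4 :=
  mem_ball.1 ((P.fine (P.gpt i j) (P.gpt_mem_range i j)).choose_spec.2 hz)

/-- The vertex `(i, j)` lies in the core of its edge chart. -/
theorem vert_mem_core_edge (i j : ℕ) : P.vert i j ∈ soloInformedCore (P.edgeChart i j) :=
  P.mem_core_edge (P.vert_mem i j) (by linarith [P.dist_vert_gpt i j, P.δ_pos])

/-- The vertex `(i + 1, j)` lies in the core of the edge chart of `(i, j)`. -/
theorem vert_succ_fst_mem_core_edge (i j : ℕ) :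
    P.vert (i + 1) j ∈ soloInformedCore (P.edgeChart i j) := by
  refine P.mem_core_edge (P.vert_mem _ _) ?_
  calc dist (P.vert (i + 1) j) (P.gpt i j)
      ≤ dist (P.vert (i + 1) j) (P.gpt (i + 1) j) + dist (P.gpt (i + 1) j) (P.gpt i j) :=
        dist_triangle _ _ _
    _ < P.δ / 4 + P.δ / 4 := add_lt_add (P.dist_vert_gpt _ _) (P.dist_gpt_succ_fst i j)
    _ ≤ P.δ := by linarith [P.δ_pos]

/-- The vertex `(i, j + 1)` lies in the core of the edge chart of `(i, j)`. -/
theorem vert_succ_snd_mem_core_edge (i j : ℕ) :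
    P.vert i (j + 1) ∈ soloInformedCore (P.edgeChart i j) := by
  refine P.mem_core_edge (P.vert_mem _ _) ?_
  calc dist (P.vert i (j + 1)) (P.gpt i j)
      ≤ dist (P.vert i (j + 1)) (P.gpt i (j + 1)) + dist (P.gpt i (j + 1)) (P.gpt i j) :=
        dist_triangle _ _ _
    _ < P.δ / 4 + P.δ / 4 := add_lt_add (P.dist_vert_gpt _ _) (P.dist_gpt_succ_snd i j)
    _ ≤ P.δ := by linarith [P.δ_pos]

end SoloInformedHTScale

end Summit.KontsevichZagierPeriods.KontsevichZagierPeriods.Theorems
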